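import Summits.QuantumFields.BalabanUV.Beta.SecondOrderSeparationCalculus
import Summits.QuantumFields.BalabanUV.Beta.ChartConjugationDefectEnd

/-!
# `BalabanUV.Beta.SecondOrderDefectWordsSep` — binder row D1, hR side of the (0.4) ROOT: **THE FOUR INNER SANDWICH-DEFECT WORDS OF THE REMAINDER
# RECURSION `hR2succ` ARE SEPARATION-LOCALISED**, generic kernels
# (β sub-cell, D1 formalisation swarm, unit `b2b-balaban-beta-d1-formalise-leaf-03`, gen 17; a supplier brick for the class step of the row-D1 OWNER
# an2's ROOT J `RowD1JointEndSymReflTablesAn1S2MWVB` (p299091), binder `hR2succ`, in leaf-05 g5's separation currency `SecondOrderSeparationCalculus`)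

NOT IN PRINT; OUR BOOKKEEPING.  HONEST FRAMING (cell contract, verbatim): «discharging `BetaPertH` makes Bałaban's UV stability
UNCONDITIONAL — a real constructive-QFT result; it is NOT the continuum limit and NOT the Clay problem.»  HONEST DEPENDENCY (verbatim):
«continuum YM on T⁴ ⇐ BetaPertH ∧ nine spine estimates (0/9 proved); BetaPertH ⇐ (D1) ∧ (D4) ∧ CAP+tail; G-an2-4 gates asym, D1 and
NE2/3/4.»  [folklore] analysis bookkeeping (exponential localisation of absolutely convergent lattice sums) over OUR objects; instantiates NO binder
of the β-function wall; no `[cite:]`, no `def`, no `def … : Prop`; NOT D1, NOT `BetaPertH`, NOT continuum, NOT Clay.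

## What (generic `K`, `𝕄` decaying at some rate; `S` a local stencil family; `M` a vertex family; `g` a bi-localised diagonal generator family; `N ≥ 1`)

ROOT J's remainder recursion `hR2succ` (tree l.127–150) transports, besides the sandwich `G_j ∘ V ∘ G_j` of the symmetrised residual `V` (leaf-05's
`SecondOrderClassStep` shape), the SUM OF FOUR INNER SANDWICH-DEFECT WORDS of `SecondOrderInverseShapeDefect.K3_sharp_defect`:
`W κuκ′u′ := 𝒮(D_{κu}) ∘ (dM_{κ′u′} ∘ K − D_{κ′u′}) + (K ∘ (dM_{κu} + conjV 𝕄 D_{κu})) ∘ 𝒮(D_{κ′u′}) + 𝒮(D_{κ′u′}) ∘ (dM_{κu} ∘ K − D_{κu}) + (K ∘ (dM_{κ′u′} + conjV 𝕄 D_{κ′u′})) ∘ 𝒮(D_{κu})`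
with `𝒮(X) := sandwichDefect K 𝕄 X = K ∘ conjV 𝕄 X ∘ K + conjV K X`, `D_{κu} := diagK (Σ_ι Σ'_v colH K N κ u ι v · g ι v)` (the dressed generator at the
bond `(κ, u)`) and `dM_{κu} := dM K N S M κ u`.  Each word is a product of a factor localised at the dilated bond `N•u` and a factor localised at
`N•u′`, so the word is bi-localised at `(N•u, N•u)` with a constant decaying in the separation `|N•u − N•u′|₁` — the currency of leaf-05's class step.
* §1 `sep_comp_vertexFamily` — the product of a member of one vertex family at `(κ, u)` with a member of another at `(κ′, u′)` is separation-localised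
  (Literature `biLoc_comp_biLoc` + `biLoc_recenter_right`: half of the product's separation decay pays for re-centring the second leg).
* §2 vertex-family closure: `vertexFamily_comp_decays_left ∕ _right`, `vertexFamily_add' ∕ _sub'`, `vertexFamily_dM'`, **`vertexFamily_sandwichDefect`**, and the two factor
  families `vertexFamily_dM_comp_sub_dressedGen` (`dM_{κu} ∘ K − D_{κu}`), `vertexFamily_comp_dM_add_conjV` (`K ∘ (dM_{κu} + conjV 𝕄 D_{κu})`).
* §3 **`sep_defectWords`** — `W` is separation-localised (`∃ C δ, 0 < δ ∧ ∀ κ u κ′ u′, BiLoc (W κuκ′u′) (N•u) (N•u) (C·e^{−δ|N•u − N•u′|₁}) δ`), the words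
  written EXACTLY as in ROOT J's `hR2succ` (with `K`, `𝕄`, `S`, `M`, `g`, `N` for `Gsym Lc j`, `bhKStepSh 3 Lc (Dsh Lc) j`, the recursive pure stencils,
  `M1Of …`, `γ_j·ctGenM …`, `Lc`).
Suppliers BY NAME: leaf-05's `SecondOrderSeparationCalculus` (`sep_add`, `sep_swap`, `vertexFamily_dressedGen`, `vertexFamily_conjV`), Literature
`SecondOrderResponse` (`vertexFamily_dM`, `biLoc_comp_biLoc`, `biLoc_recenter_right`, `biLoc_neg`), `ExpKernelCalculus.biLoc_comp_decays`,
`BalabanStepJetsSucc.biLoc_comp_right`, `KernelWard.biLoc_add ∕ biLoc_sub`.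
Provenance: β sub-cell, unit `b2b-balaban-beta-d1-formalise-leaf-03` gen 17, 2026-08-21 (v1); no existing file touched.
-/

noncomputable section

open Finset
open scoped BigOperators
open Literature.MathematicalPhysics.QuantumFieldTheory
open Literature.MathematicalPhysics.QuantumFieldTheory.Balaban1983to89
open Literature.MathematicalPhysics.QuantumFieldTheory.Balaban1983to89.Beta
open B12Sec2to5 (l1 l1_nonneg)
open ExpKernelCalculus (MKer Site Decays BiLoc VertexFamily comp Zl Zl_nonneg l1_sub_symm biLoc_comp_decays biLoc_comp_biLoc)
open KernelWard (biLoc_add biLoc_sub)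
open OneStepResolventKernel (Fib LocStencil decays_mono biLoc_mono)
open OneStepKernelFamily (colH vertexOfK)
open BalabanStepJetsSucc (biLoc_comp_right)
open BalabanStepW2 (biLoc_le_mono)
open SecondOrderResponse (dM biLoc_neg biLoc_recenter_right vertexFamily_dM)
open Summit.QuantumFields.BalabanUV.Beta.TameKernelCalculus
open Summit.QuantumFields.BalabanUV.Beta.ChartConjugation (conjV)
open Summit.QuantumFields.BalabanUV.Beta.ChartConjugationDefectEnd (sandwichDefect)
open Summit.QuantumFields.BalabanUV.Beta.BorderedHessian (diagK)
open Summit.QuantumFields.BalabanUV.Beta.SecondOrderSeparationCalculus (sep_add sep_swap vertexFamily_dressedGen vertexFamily_conjV)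

namespace Summit.QuantumFields.BalabanUV.Beta.SecondOrderDefectWordsSep

variable {d N : ℕ}

/-! ## §1 The product of two vertex-family members at two bonds is separation-localised -/

/-- [folklore] **PRODUCT OF TWO VERTEX-FAMILY MEMBERS AT TWO BONDS**: `A μ y` bi-localised at `(N•y, N•y)` and `B ν y′` at `(N•y′, N•y′)` (uniformly)
⇒ `(μ, y, ν, y′) ↦ A μ y ∘ B ν y′` is bi-localised at `(N•y, N•y)` with a constant decaying in `|N•y − N•y′|₁` (Literature `biLoc_comp_biLoc` gives the
pair `(N•y, N•y′)` with the decay `e^{−(m∕2)|N•y − N•y′|}`; half of it re-centres the second leg by `biLoc_recenter_right`). -/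
theorem sep_comp_vertexFamily {A B : Fin (d + 1) → (Fin (d + 1) → ℤ) → MKer (d + 1) (Fib d)}
    (hA : ∃ CA δA : ℝ, 0 < δA ∧ VertexFamily A N CA δA) (hB : ∃ CB δB : ℝ, 0 < δB ∧ VertexFamily B N CB δB) :
    ∃ C δ : ℝ, 0 < δ ∧ ∀ μ y ν y', BiLoc (comp (A μ y) (B ν y')) ((N : ℤ) • y) ((N : ℤ) • y)
      (C * Real.exp (-δ * l1 ((N : ℤ) • y - (N : ℤ) • y'))) δ := by
  obtain ⟨CA, δA, hδA, hA⟩ := hA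
  obtain ⟨CB, δB, hδB, hB⟩ := hB
  set m : ℝ := min δA δB with hm_def
  have hm : 0 < m := lt_min hδA hδB
  have hCA : 0 ≤ CA := (hA 0 0).nonneg (Sum.inl 0)
  have hCB : 0 ≤ CB := (hB 0 0).nonneg (Sum.inl 0)
  have hA' : ∀ μ y, BiLoc (A μ y) ((N : ℤ) • y) ((N : ℤ) • y) CA m := fun μ y => biLoc_mono (hA μ y) hCA (min_le_left _ _)
  have hB' : ∀ ν y', BiLoc (B ν y') ((N : ℤ) • y') ((N : ℤ) • y') CB m := fun ν y' => biLoc_mono (hB ν y') hCB (min_le_right _ _)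
  refine ⟨(Fintype.card (Fib d) : ℝ) * (CA * CB) * Zl (d + 1) (m / 2), m / 4, by positivity, fun μ y ν y' => ?_⟩
  have h1 := biLoc_comp_biLoc (hA' μ y) (hB' ν y') hm
  have e : (Fintype.card (Fib d) : ℝ) * (CA * CB) * Zl (d + 1) (m / 2) * Real.exp (-(m / 2) * l1 ((N : ℤ) • y - (N : ℤ) • y')) =
      (Fintype.card (Fib d) : ℝ) * (CA * CB) * Zl (d + 1) (m / 2) * Real.exp (-(m / 4) * l1 ((N : ℤ) • y - (N : ℤ) • y')) *
        Real.exp (-(m / 4) * l1 ((N : ℤ) • y - (N : ℤ) • y')) := by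
    rw [mul_assoc (_ * Zl (d + 1) (m / 2)), ← Real.exp_add]; ring_nf
  have hZ : 0 ≤ Zl (d + 1) (m / 2) := Zl_nonneg (half_pos hm)
  have h2 : BiLoc (comp (A μ y) (B ν y')) ((N : ℤ) • y) ((N : ℤ) • y')
      ((Fintype.card (Fib d) : ℝ) * (CA * CB) * Zl (d + 1) (m / 2) * Real.exp (-(m / 4) * l1 ((N : ℤ) • y - (N : ℤ) • y')) *
        Real.exp (-(m / 4) * l1 ((N : ℤ) • y - (N : ℤ) • y'))) (m / 4) :=
    biLoc_le_mono h1 (by positivity) (le_of_eq e) (by linarith)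
  exact biLoc_recenter_right h2 (by positivity) (by positivity) le_rfl

/-! ## §2 Vertex-family closure -/

section VF

variable {K 𝕄 : MKer (d + 1) (Fib d)} {A B : Fin (d + 1) → (Fin (d + 1) → ℤ) → MKer (d + 1) (Fib d)}

/-- [folklore] Sum of two vertex families. -/
theorem vertexFamily_add' (hA : ∃ CA δA : ℝ, 0 < δA ∧ VertexFamily A N CA δA) (hB : ∃ CB δB : ℝ, 0 < δB ∧ VertexFamily B N CB δB) :
    ∃ C δ : ℝ, 0 < δ ∧ VertexFamily (fun ν y' => A ν y' + B ν y') N C δ := by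
  obtain ⟨CA, δA, hδA, hA⟩ := hA
  obtain ⟨CB, δB, hδB, hB⟩ := hB
  have hCA : 0 ≤ CA := (hA 0 0).nonneg (Sum.inl 0)
  have hCB : 0 ≤ CB := (hB 0 0).nonneg (Sum.inl 0)
  exact ⟨CA + CB, min δA δB, lt_min hδA hδB, fun ν y' =>
    biLoc_add (biLoc_mono (hA ν y') hCA (min_le_left _ _)) (biLoc_mono (hB ν y') hCB (min_le_right _ _))⟩

/-- [folklore] Difference of two vertex families. -/
theorem vertexFamily_sub' (hA : ∃ CA δA : ℝ, 0 < δA ∧ VertexFamily A N CA δA) (hB : ∃ CB δB : ℝ, 0 < δB ∧ VertexFamily B N CB δB) :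
    ∃ C δ : ℝ, 0 < δ ∧ VertexFamily (fun ν y' => A ν y' - B ν y') N C δ := by
  obtain ⟨CA, δA, hδA, hA⟩ := hA
  obtain ⟨CB, δB, hδB, hB⟩ := hB
  have hCA : 0 ≤ CA := (hA 0 0).nonneg (Sum.inl 0)
  have hCB : 0 ≤ CB := (hB 0 0).nonneg (Sum.inl 0)
  exact ⟨CA + CB, min δA δB, lt_min hδA hδB, fun ν y' =>
    biLoc_sub (biLoc_mono (hA ν y') hCA (min_le_left _ _)) (biLoc_mono (hB ν y') hCB (min_le_right _ _))⟩

/-- [folklore] Left composition with a decaying kernel preserves vertex families. -/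
theorem vertexFamily_comp_decays_left (hK : ∃ δ C : ℝ, 0 < δ ∧ 0 ≤ C ∧ Decays K C δ) (hA : ∃ CA δA : ℝ, 0 < δA ∧ VertexFamily A N CA δA) :
    ∃ C δ : ℝ, 0 < δ ∧ VertexFamily (fun ν y' => comp K (A ν y')) N C δ := by
  obtain ⟨δK, CK, hδK, hCK, hKd⟩ := hK
  obtain ⟨CA, δA, hδA, hA⟩ := hA
  set m : ℝ := min δK δA with hm_def
  have hm : 0 < m := lt_min hδK hδA
  have hCA : 0 ≤ CA := (hA 0 0).nonneg (Sum.inl 0)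
  have hKm : Decays K CK m := decays_mono hKd hCK le_rfl (min_le_left _ _)
  refine ⟨(Fintype.card (Fib d) : ℝ) * (CK * CA) * Zl (d + 1) (m - m / 2), m / 2, half_pos hm, fun ν y' => ?_⟩
  exact biLoc_comp_decays hKm (biLoc_mono (hA ν y') hCA (min_le_right _ _)) (half_pos hm).le (half_lt_self hm)

/-- [folklore] Right composition with a decaying kernel preserves vertex families. -/
theorem vertexFamily_comp_decays_right (hK : ∃ δ C : ℝ, 0 < δ ∧ 0 ≤ C ∧ Decays K C δ) (hA : ∃ CA δA : ℝ, 0 < δA ∧ VertexFamily A N CA δA) :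
    ∃ C δ : ℝ, 0 < δ ∧ VertexFamily (fun ν y' => comp (A ν y') K) N C δ := by
  obtain ⟨δK, CK, hδK, hCK, hKd⟩ := hK
  obtain ⟨CA, δA, hδA, hA⟩ := hA
  set m : ℝ := min δK δA with hm_def
  have hm : 0 < m := lt_min hδK hδA
  have hCA : 0 ≤ CA := (hA 0 0).nonneg (Sum.inl 0)
  have hKm : Decays K CK m := decays_mono hKd hCK le_rfl (min_le_left _ _)
  refine ⟨(Fintype.card (Fib d) : ℝ) * (CA * CK) * Zl (d + 1) (m - m / 2), m / 2, half_pos hm, fun ν y' => ?_⟩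
  exact biLoc_comp_right (biLoc_mono (hA ν y') hCA (min_le_right _ _)) hKm (half_pos hm).le (half_lt_self hm)

/-- [folklore] The `∃`-currency form of Literature `SecondOrderResponse.vertexFamily_dM`: the Lagrangian-chart vertex family over a local `S` and a
coarse-local `M` is a vertex family. -/
theorem vertexFamily_dM' [NeZero N] (hK : ∃ δ C : ℝ, 0 < δ ∧ 0 ≤ C ∧ Decays K C δ)
    {S : Fin (d + 1) → (Fin (d + 1) → ℤ) → MKer (d + 1) (Fib d)} (hS : ∃ Cs δs : ℝ, 0 < δs ∧ LocStencil S Cs δs)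
    {M : Fin (d + 1) → (Fin (d + 1) → ℤ) → MKer (d + 1) (Fib d)} (hM : ∃ CM δM : ℝ, 0 < δM ∧ VertexFamily M N CM δM) :
    ∃ C δ : ℝ, 0 < δ ∧ VertexFamily (dM K N S M) N C δ := by
  obtain ⟨δK, CK, hδK, hCK, hKd⟩ := hK
  obtain ⟨Cs, δs, hδs, hS⟩ := hS
  obtain ⟨CM, δM, hδM, hM⟩ := hM
  set m : ℝ := min δK (min δs δM) with hm_def
  have hm : 0 < m := lt_min hδK (lt_min hδs hδM)
  have hCs : 0 ≤ Cs := (hS 0 0).nonneg (Sum.inl 0)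
  have hCM : 0 ≤ CM := (hM 0 0).nonneg (Sum.inl 0)
  have hS' : LocStencil S Cs m := fun κ u => biLoc_mono (hS κ u) hCs ((min_le_right _ _).trans (min_le_left _ _))
  have hM' : VertexFamily M N CM m := fun μ w => biLoc_mono (hM μ w) hCM ((min_le_right _ _).trans (min_le_right _ _))
  exact ⟨_, m / 2, half_pos hm, vertexFamily_dM hKd hCK hS' hM' hm (min_le_left _ _)⟩

/-- [folklore] **THE SANDWICH DEFECT OF A VERTEX FAMILY IS A VERTEX FAMILY**: `𝒮(X_c) = K ∘ conjV 𝕄 X_c ∘ K + conjV K X_c` for decaying `K`, `𝕄`. -/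
theorem vertexFamily_sandwichDefect (hK : ∃ δ C : ℝ, 0 < δ ∧ 0 ≤ C ∧ Decays K C δ) (h𝕄 : ∃ δ C : ℝ, 0 < δ ∧ 0 ≤ C ∧ Decays 𝕄 C δ)
    (hA : ∃ CA δA : ℝ, 0 < δA ∧ VertexFamily A N CA δA) :
    ∃ C δ : ℝ, 0 < δ ∧ VertexFamily (fun ν y' => sandwichDefect K 𝕄 (A ν y')) N C δ := by
  have h1 := vertexFamily_comp_decays_right hK (vertexFamily_comp_decays_left hK (vertexFamily_conjV (N := N) h𝕄 hA))
  have h2 := vertexFamily_conjV (N := N) hK hA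
  have h := vertexFamily_add' h1 h2
  exact h

end VF

/-! ## §3 The four inner sandwich-defect words are separation-localised -/

section Words

variable {K 𝕄 : MKer (d + 1) (Fib d)}

/-- [folklore] The family `κ u ↦ dM K N S M κ u ∘ K − D_{κu}` is a vertex family (`D` the dressed generator family). -/
theorem vertexFamily_dM_comp_sub_dressedGen [NeZero N] (hK : ∃ δ C : ℝ, 0 < δ ∧ 0 ≤ C ∧ Decays K C δ)
    {S : Fin (d + 1) → (Fin (d + 1) → ℤ) → MKer (d + 1) (Fib d)} (hS : ∃ Cs δs : ℝ, 0 < δs ∧ LocStencil S Cs δs)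
    {M : Fin (d + 1) → (Fin (d + 1) → ℤ) → MKer (d + 1) (Fib d)} (hM : ∃ CM δM : ℝ, 0 < δM ∧ VertexFamily M N CM δM)
    {g : Fin (d + 1) → (Fin (d + 1) → ℤ) → (Fin (d + 1) → ℤ) → Fib d → ℝ} (hgl : ∃ Cg δg : ℝ, 0 < δg ∧ LocStencil (fun κ u => diagK (g κ u)) Cg δg) :
    ∃ C δ : ℝ, 0 < δ ∧ VertexFamily (fun κ u => comp (dM K N S M κ u) K - diagK fun p c => ∑ ι, ∑' v, colH K N κ u ι v * g ι v p c) N C δ :=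
  vertexFamily_sub' (vertexFamily_comp_decays_right hK (vertexFamily_dM' hK hS hM)) (vertexFamily_dressedGen hK hgl)

/-- [folklore] The family `κ u ↦ K ∘ (dM K N S M κ u + conjV 𝕄 D_{κu})` is a vertex family. -/
theorem vertexFamily_comp_dM_add_conjV [NeZero N] (hK : ∃ δ C : ℝ, 0 < δ ∧ 0 ≤ C ∧ Decays K C δ)
    (h𝕄 : ∃ δ C : ℝ, 0 < δ ∧ 0 ≤ C ∧ Decays 𝕄 C δ)
    {S : Fin (d + 1) → (Fin (d + 1) → ℤ) → MKer (d + 1) (Fib d)} (hS : ∃ Cs δs : ℝ, 0 < δs ∧ LocStencil S Cs δs)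
    {M : Fin (d + 1) → (Fin (d + 1) → ℤ) → MKer (d + 1) (Fib d)} (hM : ∃ CM δM : ℝ, 0 < δM ∧ VertexFamily M N CM δM)
    {g : Fin (d + 1) → (Fin (d + 1) → ℤ) → (Fin (d + 1) → ℤ) → Fib d → ℝ} (hgl : ∃ Cg δg : ℝ, 0 < δg ∧ LocStencil (fun κ u => diagK (g κ u)) Cg δg) :
    ∃ C δ : ℝ, 0 < δ ∧ VertexFamily
      (fun κ u => comp K (dM K N S M κ u + conjV 𝕄 (diagK fun p c => ∑ ι, ∑' v, colH K N κ u ι v * g ι v p c))) N C δ :=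
  vertexFamily_comp_decays_left hK
    (vertexFamily_add' (vertexFamily_dM' hK hS hM) (vertexFamily_conjV h𝕄 (vertexFamily_dressedGen hK hgl)))

/-- [folklore] **THE FOUR INNER SANDWICH-DEFECT WORDS OF `hR2succ` ARE SEPARATION-LOCALISED** (decaying `K`, `𝕄`; local `S`; coarse-local `M`;
bi-localised diagonal generator family `g`; `N ≥ 1`): the sum, word for word as ROOT J displays it, is bi-localised at the dilated first bond with a
constant decaying in the dilated separation. -/
theorem sep_defectWords [NeZero N] (hK : ∃ δ C : ℝ, 0 < δ ∧ 0 ≤ C ∧ Decays K C δ) (h𝕄 : ∃ δ C : ℝ, 0 < δ ∧ 0 ≤ C ∧ Decays 𝕄 C δ)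
    {S : Fin (d + 1) → (Fin (d + 1) → ℤ) → MKer (d + 1) (Fib d)} (hS : ∃ Cs δs : ℝ, 0 < δs ∧ LocStencil S Cs δs)
    {M : Fin (d + 1) → (Fin (d + 1) → ℤ) → MKer (d + 1) (Fib d)} (hM : ∃ CM δM : ℝ, 0 < δM ∧ VertexFamily M N CM δM)
    {g : Fin (d + 1) → (Fin (d + 1) → ℤ) → (Fin (d + 1) → ℤ) → Fib d → ℝ} (hgl : ∃ Cg δg : ℝ, 0 < δg ∧ LocStencil (fun κ u => diagK (g κ u)) Cg δg) :
    ∃ C δ : ℝ, 0 < δ ∧ ∀ (κ : Fin (d + 1)) (u : Fin (d + 1) → ℤ) (κ' : Fin (d + 1)) (u' : Fin (d + 1) → ℤ),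
      BiLoc
        (comp (sandwichDefect K 𝕄 (diagK fun p c => ∑ ι, ∑' v, colH K N κ u ι v * g ι v p c))
            (comp (dM K N S M κ' u') K - diagK fun p c => ∑ ι, ∑' v, colH K N κ' u' ι v * g ι v p c)
          + comp (comp K (dM K N S M κ u + conjV 𝕄 (diagK fun p c => ∑ ι, ∑' v, colH K N κ u ι v * g ι v p c)))
            (sandwichDefect K 𝕄 (diagK fun p c => ∑ ι, ∑' v, colH K N κ' u' ι v * g ι v p c))
          + comp (sandwichDefect K 𝕄 (diagK fun p c => ∑ ι, ∑' v, colH K N κ' u' ι v * g ι v p c))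
            (comp (dM K N S M κ u) K - diagK fun p c => ∑ ι, ∑' v, colH K N κ u ι v * g ι v p c)
          + comp (comp K (dM K N S M κ' u' + conjV 𝕄 (diagK fun p c => ∑ ι, ∑' v, colH K N κ' u' ι v * g ι v p c)))
            (sandwichDefect K 𝕄 (diagK fun p c => ∑ ι, ∑' v, colH K N κ u ι v * g ι v p c)))
        ((N : ℤ) • u) ((N : ℤ) • u) (C * Real.exp (-δ * l1 ((N : ℤ) • u - (N : ℤ) • u'))) δ := by
  -- the four factor families
  have hSW := vertexFamily_sandwichDefect (N := N) hK h𝕄 (vertexFamily_dressedGen hK hgl)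
  have hB := vertexFamily_dM_comp_sub_dressedGen hK hS hM hgl
  have hA := vertexFamily_comp_dM_add_conjV hK h𝕄 hS hM hgl
  -- words 1 and 2: first factor at `(κ, u)`, second at `(κ′, u′)`
  have w1 := sep_comp_vertexFamily hSW hB
  have w2 := sep_comp_vertexFamily hA hSW
  -- words 3 and 4: the swapped products
  have w3 := sep_swap (sep_comp_vertexFamily hSW hB)
  have w4 := sep_swap (sep_comp_vertexFamily hA hSW)
  exact sep_add (sep_add (sep_add w1 w2) w3) w4

end Words

end Summit.QuantumFields.BalabanUV.Beta.SecondOrderDefectWordsSep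

end
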